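import Mathlib
import Summits.Ventures.PercRepro2.SkeletonReduction
import Summits.Ventures.PercRepro2.ParallelMerge

/-!
# THE SKELETON REDUCTION TO SIMPLE GRAPHS (blind cell PercRepro2, night-1 g15; NIGHT1-G15.md §5)

`SkeletonReduction` reduced the crux to the instances without unmarked vertices of nonzero-degree
`1` or `2`.  Adding the LOOP rule everywhere and the PARALLEL rule (`ParallelMerge`: two parallel
edges merge into one coin `1 − (1 − p₁)(1 − p₂)`; here also for `Gc`, `Gc_merge`) gives the reduction
to SIMPLE instances (`Simple`: reduced, no nonzero loop, no two distinct nonzero-weight edges with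
the same ends): **`HCov_of_simple` / `HMF_of_simple`** — if (HCOV) [resp. (HMF)] holds on every
simple instance on `(E, V)`, it holds on every instance (the strong induction of `SkeletonReduction`
with the merge as a fourth move, each move removing one nonzero edge).  So the crux on all finite
(multi)graphs is the crux on simple graphs whose unmarked vertices have degree `≥ 3`
(`HCov_all_of_simple`).
-/

open scoped Classical

namespace Summit.Ventures.PercRepro2

open UnionCluster CovForm PendantRoot

namespace Skeleton
section Merge

variable {V : Type*} {E : Type*} [Fintype E] [DecidableEq E] [Fintype V] [DecidableEq V]
  {R : Type*} [Field R] [LinearOrder R] [IsStrictOrderedRing R]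

variable (p : E → R) (ends : E → Sym2 V) {e₁ e₂ : E} (hne : e₁ ≠ e₂) (hpar : ends e₁ = ends e₂)
include hne hpar

omit [Fintype V] [DecidableEq V] [LinearOrder R] [IsStrictOrderedRing R] in
/-- **The cleared (HCOV) functional is invariant under merging two parallel edges** (the `Gc`
companion of `ParallelMerge.HMFc_merge`). -/
theorem Gc_merge (o a₁ a₂ a₃ b : V) :
    Gc p ends o a₁ a₂ a₃ b =
      Gc (Function.update (Function.update p e₁ (1 - (1 - p e₁) * (1 - p e₂))) e₂ 0) ends
        o a₁ a₂ a₃ b := by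
  have hQ0 : prob p (avoidAll ends a₂ {a₁}) =
      prob (Function.update (Function.update p e₁ (1 - (1 - p e₁) * (1 - p e₂))) e₂ 0)
        (avoidAll ends a₂ {a₁}) :=
    ParallelMerge.prob_merge_of p ends hne hpar _ (fun h h' => ParallelMerge.parInv_avoidAll h h' a₂ {a₁})
  have hQ : ∀ x y, prob p (avoidAll ends a₂ {a₁} ∩ connEvent ends x y) =
      prob (Function.update (Function.update p e₁ (1 - (1 - p e₁) * (1 - p e₂))) e₂ 0)
        (avoidAll ends a₂ {a₁} ∩ connEvent ends x y) := fun x y =>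
    ParallelMerge.prob_merge_of p ends hne hpar _ (fun h h' =>
      (ParallelMerge.parInv_avoidAll h h' a₂ {a₁}).inter (ParallelMerge.parInv_connEvent h h' x y))
  have hQcc : ∀ x y x' y',
      prob p (avoidAll ends a₂ {a₁} ∩ (connEvent ends x y ∩ connEvent ends x' y')) =
        prob (Function.update (Function.update p e₁ (1 - (1 - p e₁) * (1 - p e₂))) e₂ 0)
          (avoidAll ends a₂ {a₁} ∩ (connEvent ends x y ∩ connEvent ends x' y')) :=
    fun x y x' y' => ParallelMerge.prob_merge_of p ends hne hpar _ (fun h h' =>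
      (ParallelMerge.parInv_avoidAll h h' a₂ {a₁}).inter
        ((ParallelMerge.parInv_connEvent h h' x y).inter (ParallelMerge.parInv_connEvent h h' x' y')))
  have hPD0 : prob p (PDEvent ends a₁ a₂ a₃) =
      prob (Function.update (Function.update p e₁ (1 - (1 - p e₁) * (1 - p e₂))) e₂ 0)
        (PDEvent ends a₁ a₂ a₃) :=
    ParallelMerge.prob_merge_of p ends hne hpar _ (fun h h' => ParallelMerge.parInv_PDEvent h h' a₁ a₂ a₃)
  have hPD : ∀ x y, prob p (PDEvent ends a₁ a₂ a₃ ∩ connEvent ends x y) =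
      prob (Function.update (Function.update p e₁ (1 - (1 - p e₁) * (1 - p e₂))) e₂ 0)
        (PDEvent ends a₁ a₂ a₃ ∩ connEvent ends x y) := fun x y =>
    ParallelMerge.prob_merge_of p ends hne hpar _ (fun h h' =>
      (ParallelMerge.parInv_PDEvent h h' a₁ a₂ a₃).inter (ParallelMerge.parInv_connEvent h h' x y))
  have hPDcc : ∀ x y x' y',
      prob p (PDEvent ends a₁ a₂ a₃ ∩ (connEvent ends x y ∩ connEvent ends x' y')) =
        prob (Function.update (Function.update p e₁ (1 - (1 - p e₁) * (1 - p e₂))) e₂ 0)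
          (PDEvent ends a₁ a₂ a₃ ∩ (connEvent ends x y ∩ connEvent ends x' y')) :=
    fun x y x' y' => ParallelMerge.prob_merge_of p ends hne hpar _ (fun h h' =>
      (ParallelMerge.parInv_PDEvent h h' a₁ a₂ a₃).inter
        ((ParallelMerge.parInv_connEvent h h' x y).inter (ParallelMerge.parInv_connEvent h h' x' y')))
  have hT0 : ∀ x y z, prob p (TEvent ends x y z) =
      prob (Function.update (Function.update p e₁ (1 - (1 - p e₁) * (1 - p e₂))) e₂ 0)
        (TEvent ends x y z) := fun x y z =>
    ParallelMerge.prob_merge_of p ends hne hpar _ (fun h h' => ParallelMerge.parInv_TEvent h h' x y z)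
  have hT : ∀ x y z x' y', prob p (TEvent ends x y z ∩ connEvent ends x' y') =
      prob (Function.update (Function.update p e₁ (1 - (1 - p e₁) * (1 - p e₂))) e₂ 0)
        (TEvent ends x y z ∩ connEvent ends x' y') := fun x y z x' y' =>
    ParallelMerge.prob_merge_of p ends hne hpar _ (fun h h' =>
      (ParallelMerge.parInv_TEvent h h' x y z).inter (ParallelMerge.parInv_connEvent h h' x' y'))
  have hTcc : ∀ x y z x' y' x'' y'',
      prob p (TEvent ends x y z ∩ (connEvent ends x' y' ∩ connEvent ends x'' y'')) =
        prob (Function.update (Function.update p e₁ (1 - (1 - p e₁) * (1 - p e₂))) e₂ 0)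
          (TEvent ends x y z ∩ (connEvent ends x' y' ∩ connEvent ends x'' y'')) :=
    fun x y z x' y' x'' y'' => ParallelMerge.prob_merge_of p ends hne hpar _ (fun h h' =>
      (ParallelMerge.parInv_TEvent h h' x y z).inter
        ((ParallelMerge.parInv_connEvent h h' x' y').inter
          (ParallelMerge.parInv_connEvent h h' x'' y'')))
  have hc : ∀ x y, prob p (connEvent ends x y) =
      prob (Function.update (Function.update p e₁ (1 - (1 - p e₁) * (1 - p e₂))) e₂ 0)
        (connEvent ends x y) := fun x y =>
    ParallelMerge.prob_merge_of p ends hne hpar _ (fun h h' => ParallelMerge.parInv_connEvent h h' x y)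
  simp only [Gc, EQbo, EQb3, EQb3o, Do, gap, DEF, EQo, EQ3, EQ3o, PDb, PDbo]
  simp only [hQ0, hQ, hQcc, hPD0, hPD, hPDcc, hT0, hT, hTcc, hc]

omit [Fintype V] [DecidableEq V] [IsStrictOrderedRing R] in
/-- **(HCOV) is invariant under merging two parallel edges.** -/
theorem HCov_merge_iff (o a₁ a₂ a₃ b : V) :
    HCov p ends o a₁ a₂ a₃ b ↔
      HCov (Function.update (Function.update p e₁ (1 - (1 - p e₁) * (1 - p e₂))) e₂ 0) ends
        o a₁ a₂ a₃ b := by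
  unfold HCov
  rw [Gc_merge p ends hne hpar]

end Merge

section Simple

variable {V : Type*} {E : Type*} [Fintype E] [DecidableEq E] [Fintype V] [DecidableEq V]
  {R : Type*} [Field R] [LinearOrder R] [IsStrictOrderedRing R]

omit [Fintype V] [DecidableEq V] in
/-- The merge removes exactly `e₂` from the nonzero edges (the merged coin of two nonzero coins is
nonzero). -/
lemma nz_merge (p : E → R) {e₁ e₂ : E} (hne : e₁ ≠ e₂) (hp : IsProbVec p) (h1 : p e₁ ≠ 0) :
    nz (Function.update (Function.update p e₁ (1 - (1 - p e₁) * (1 - p e₂))) e₂ 0) =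
      (nz p).erase e₂ := by
  have hpos : 0 < p e₁ := lt_of_le_of_ne (hp.nonneg e₁) (Ne.symm h1)
  have hm : (1 - (1 - p e₁) * (1 - p e₂)) ≠ 0 := by
    have h2 := hp.nonneg e₂
    have h3 := hp.le_one e₁
    have h4 := hp.le_one e₂
    have : (1 - p e₁) * (1 - p e₂) < 1 := by nlinarith
    exact ne_of_gt (by linarith)
  ext e
  simp only [mem_nz, Finset.mem_erase]
  by_cases he2 : e = e₂
  · subst he2; simp
  · rw [Function.update_of_ne he2]
    by_cases he1 : e = e₁
    · subst he1
      simp [he2, hm, h1]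
    · simp [Function.update_of_ne he1, he2]

/-- **Simple instance**: reduced, no nonzero loop anywhere, and no two distinct nonzero-weight edges
with the same ends. -/
def Simple (p : E → R) (ends : E → Sym2 V) (o a₁ a₂ a₃ b : V) : Prop :=
  Reduced p ends o a₁ a₂ a₃ b ∧ (∀ e, p e ≠ 0 → ¬ (ends e).IsDiag) ∧
    ∀ e₁ e₂, p e₁ ≠ 0 → p e₂ ≠ 0 → e₁ ≠ e₂ → ends e₁ ≠ ends e₂

/-- **THE SKELETON REDUCTION OF (HCOV) TO SIMPLE GRAPHS.** -/
theorem HCov_of_simple (o a₁ a₂ a₃ b : V)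
    (H : ∀ (p : E → R) (ends : E → Sym2 V), IsProbVec p → Simple p ends o a₁ a₂ a₃ b →
      HCov p ends o a₁ a₂ a₃ b) :
    ∀ (p : E → R) (ends : E → Sym2 V), IsProbVec p → HCov p ends o a₁ a₂ a₃ b := by
  suffices key : ∀ n : ℕ, ∀ (p : E → R) (ends : E → Sym2 V), IsProbVec p → (nz p).card = n →
      HCov p ends o a₁ a₂ a₃ b from fun p ends hp => key _ p ends hp rfl
  intro n
  induction n using Nat.strong_induction_on with
  | _ n ih =>
  intro p ends hp hn
  by_cases hpar : ∃ e₁ e₂, p e₁ ≠ 0 ∧ p e₂ ≠ 0 ∧ e₁ ≠ e₂ ∧ ends e₁ = ends e₂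
  · -- two parallel nonzero edges: merge them
    obtain ⟨e₁, e₂, h1, h2, hne, hpar⟩ := hpar
    have hmem : e₂ ∈ nz p := mem_nz.2 h2
    have hcard : (nz (Function.update (Function.update p e₁ (1 - (1 - p e₁) * (1 - p e₂))) e₂ 0)).card
        < n := by
      rw [nz_merge p hne hp h1, Finset.card_erase_of_mem hmem, hn]
      exact Nat.sub_lt (Nat.pos_of_ne_zero (by rw [← hn]; exact Finset.card_ne_zero_of_mem hmem))
        Nat.one_pos
    have hres := ih _ hcard _ ends (ParallelMerge.isProbVec_merge p ends hne hpar hp) rfl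
    exact (HCov_merge_iff p ends hne hpar o a₁ a₂ a₃ b).2 hres
  by_cases hloop : ∃ e, p e ≠ 0 ∧ (ends e).IsDiag
  · -- a nonzero loop anywhere: zero it
    obtain ⟨e, hpe, he⟩ := hloop
    obtain ⟨x, hx⟩ : ∃ x, ends e = s(x, x) := by
      revert he
      generalize ends e = z
      induction z using Sym2.ind with
      | _ y z' => intro hz; exact ⟨y, by rw [Sym2.mk_isDiag_iff.1 hz]⟩
    have hmem : e ∈ nz p := mem_nz.2 hpe
    have hcard : (nz (Function.update p e 0)).card < n := by
      rw [nz_update_zero, Finset.card_erase_of_mem hmem, hn]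
      exact Nat.sub_lt (Nat.pos_of_ne_zero (by rw [← hn]; exact Finset.card_ne_zero_of_mem hmem))
        Nat.one_pos
    have hres := ih _ hcard (Function.update p e 0) ends (hp.update e le_rfl zero_le_one) rfl
    unfold HCov at hres ⊢
    rwa [Gc_update_zero_of_loop p ends hx] at hres
  · -- no parallel pair, no loop: the reduced case is simple, otherwise leaf / series moves
    have hnopar : ∀ e₁ e₂, p e₁ ≠ 0 → p e₂ ≠ 0 → e₁ ≠ e₂ → ends e₁ ≠ ends e₂ :=
      fun e₁ e₂ h1 h2 hne h => hpar ⟨e₁, e₂, h1, h2, hne, h⟩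
    have hnoloopAll : ∀ e, p e ≠ 0 → ¬ (ends e).IsDiag := fun e h1 h => hloop ⟨e, h1, h⟩
    by_cases hred : Reduced p ends o a₁ a₂ a₃ b
    · exact H p ends hp ⟨hred, hnoloopAll, hnopar⟩
    obtain ⟨v, hvo, hv1, hv2, hv3, hvb, hviol⟩ : ∃ v, v ≠ o ∧ v ≠ a₁ ∧ v ≠ a₂ ∧ v ≠ a₃ ∧ v ≠ b ∧
        ¬ ((∀ e, p e ≠ 0 → ends e ≠ s(v, v)) ∧ (nzDeg p ends v = 0 ∨ 3 ≤ nzDeg p ends v)) := by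
      by_contra hcon
      apply hred
      intro v hvo hv1 hv2 hv3 hvb
      by_contra h
      exact hcon ⟨v, hvo, hv1, hv2, hv3, hvb, h⟩
    have hnoloop : ∀ e, p e ≠ 0 → ends e ≠ s(v, v) := fun e hpe he =>
      hnoloopAll e hpe (by rw [he]; exact Sym2.mk_isDiag_iff.2 rfl)
    have hdeg : nzDeg p ends v = 1 ∨ nzDeg p ends v = 2 := by
      by_contra h
      apply hviol
      refine ⟨hnoloop, ?_⟩
      omega
    set ends' := reroute p ends a₁ with hends'
    have hagree : ∀ e, p e ≠ 0 → ends e = ends' e := fun e he => (reroute_of_ne p ends a₁ he).symm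
    have hGc : Gc p ends o a₁ a₂ a₃ b = Gc p ends' o a₁ a₂ a₃ b :=
      Gc_congr_nz p hagree o a₁ a₂ a₃ b
    have hS : (Finset.univ.filter (fun e => v ∈ ends' e)).card = nzDeg p ends v :=
      card_filter_reroute p ends hv1
    have hnz : ∀ e, v ∈ ends' e → p e ≠ 0 := fun e he => ne_zero_of_mem_reroute p ends hv1 he
    have hnoloop' : ∀ e, v ∈ ends' e → ends' e ≠ s(v, v) := fun e he h =>
      hnoloop e (hnz e he) (by rw [hagree e (hnz e he)]; exact h)
    unfold HCov
    rw [hGc]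
    rcases hdeg with h1 | h2
    · rw [← hS, Finset.card_eq_one] at h1
      obtain ⟨f, hf⟩ := h1
      have hvf : v ∈ ends' f := by
        have : f ∈ Finset.univ.filter (fun e => v ∈ ends' e) := by
          rw [hf]; exact Finset.mem_singleton_self f
        simpa using this
      have hleaf : ∀ e, v ∈ ends' e → e = f := fun e he => by
        have : e ∈ Finset.univ.filter (fun e => v ∈ ends' e) := by simpa using he
        rw [hf] at this
        exact Finset.mem_singleton.1 this
      obtain ⟨y, hy⟩ := Sym2.mem_iff_exists.1 hvf
      have hvy : v ≠ y := fun h => hnoloop' f hvf (by rw [hy, h])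
      have hpf : p f ≠ 0 := hnz f hvf
      have hmem : f ∈ nz p := mem_nz.2 hpf
      have hcard : (nz (Function.update p f 0)).card < n := by
        rw [nz_update_zero, Finset.card_erase_of_mem hmem, hn]
        exact Nat.sub_lt
          (Nat.pos_of_ne_zero (by rw [← hn]; exact Finset.card_ne_zero_of_mem hmem)) Nat.one_pos
      have hres := ih _ hcard (Function.update p f 0) ends' (hp.update f le_rfl zero_le_one) rfl
      unfold HCov at hres
      rwa [SeriesCollapse.Gc_update_leaf p hy hleaf hvy hvo hv1 hv2 hv3 hvb 0] at hres
    · rw [← hS, Finset.card_eq_two] at h2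
      obtain ⟨f, f', hff, hS2⟩ := h2
      have hmemS : ∀ e, v ∈ ends' e ↔ e = f ∨ e = f' := fun e => by
        have : e ∈ Finset.univ.filter (fun e => v ∈ ends' e) ↔ e ∈ ({f, f'} : Finset E) := by
          rw [hS2]
        simpa using this
      have hvf : v ∈ ends' f := (hmemS f).2 (Or.inl rfl)
      have hvf' : v ∈ ends' f' := (hmemS f').2 (Or.inr rfl)
      have hdeg2 : ∀ e, v ∈ ends' e → e = f ∨ e = f' := fun e he => (hmemS e).1 he
      obtain ⟨w, hw⟩ := Sym2.mem_iff_exists.1 hvf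
      obtain ⟨w', hw'⟩ := Sym2.mem_iff_exists.1 hvf'
      have hvw : v ≠ w := fun h => hnoloop' f hvf (by rw [hw, h])
      have hvw' : v ≠ w' := fun h => hnoloop' f' hvf' (by rw [hw', h])
      have hpf' : p f' ≠ 0 := hnz f' hvf'
      have hmem : f' ∈ nz p := mem_nz.2 hpf'
      have hcard : (nz (Function.update (Function.update p f (p f * p f')) f' 0)).card < n := by
        rw [nz_contract p hff hpf', Finset.card_erase_of_mem hmem, hn]
        exact Nat.sub_lt
          (Nat.pos_of_ne_zero (by rw [← hn]; exact Finset.card_ne_zero_of_mem hmem)) Nat.one_pos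
      have hp₂ : IsProbVec (Function.update (Function.update p f (p f * p f')) f' 0) :=
        (hp.update f (mul_nonneg (hp.nonneg f) (hp.nonneg f'))
          (mul_le_one₀ (hp.le_one f) (hp.nonneg f') (hp.le_one f'))).update f' le_rfl zero_le_one
      have hres := ih _ hcard _ (Function.update ends' f s(w, w')) hp₂ rfl
      exact (SeriesCollapse.HCov_series_contract p hp hff hw hw' hdeg2 hvw hvw' hvo.symm hv1.symm
        hv2.symm hv3.symm hvb.symm).2 hres

/-- **THE SKELETON REDUCTION OF (HMF) TO SIMPLE GRAPHS.** -/
theorem HMF_of_simple (o a₁ a₂ a₃ b : V)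
    (H : ∀ (p : E → R) (ends : E → Sym2 V), IsProbVec p → Simple p ends o a₁ a₂ a₃ b →
      HMF p ends o a₁ a₂ a₃ b) :
    ∀ (p : E → R) (ends : E → Sym2 V), IsProbVec p → HMF p ends o a₁ a₂ a₃ b := by
  suffices key : ∀ n : ℕ, ∀ (p : E → R) (ends : E → Sym2 V), IsProbVec p → (nz p).card = n →
      HMF p ends o a₁ a₂ a₃ b from fun p ends hp => key _ p ends hp rfl
  intro n
  induction n using Nat.strong_induction_on with
  | _ n ih =>
  intro p ends hp hn
  by_cases hpar : ∃ e₁ e₂, p e₁ ≠ 0 ∧ p e₂ ≠ 0 ∧ e₁ ≠ e₂ ∧ ends e₁ = ends e₂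
  · -- two parallel nonzero edges: merge them
    obtain ⟨e₁, e₂, h1, h2, hne, hpar⟩ := hpar
    have hmem : e₂ ∈ nz p := mem_nz.2 h2
    have hcard : (nz (Function.update (Function.update p e₁ (1 - (1 - p e₁) * (1 - p e₂))) e₂ 0)).card
        < n := by
      rw [nz_merge p hne hp h1, Finset.card_erase_of_mem hmem, hn]
      exact Nat.sub_lt (Nat.pos_of_ne_zero (by rw [← hn]; exact Finset.card_ne_zero_of_mem hmem))
        Nat.one_pos
    have hres := ih _ hcard _ ends (ParallelMerge.isProbVec_merge p ends hne hpar hp) rfl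
    exact (ParallelMerge.HMF_merge_iff p ends hne hpar o a₁ a₂ a₃ b).2 hres
  by_cases hloop : ∃ e, p e ≠ 0 ∧ (ends e).IsDiag
  · -- a nonzero loop anywhere: zero it
    obtain ⟨e, hpe, he⟩ := hloop
    obtain ⟨x, hx⟩ : ∃ x, ends e = s(x, x) := by
      revert he
      generalize ends e = z
      induction z using Sym2.ind with
      | _ y z' => intro hz; exact ⟨y, by rw [Sym2.mk_isDiag_iff.1 hz]⟩
    have hmem : e ∈ nz p := mem_nz.2 hpe
    have hcard : (nz (Function.update p e 0)).card < n := by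
      rw [nz_update_zero, Finset.card_erase_of_mem hmem, hn]
      exact Nat.sub_lt (Nat.pos_of_ne_zero (by rw [← hn]; exact Finset.card_ne_zero_of_mem hmem))
        Nat.one_pos
    have hres := ih _ hcard (Function.update p e 0) ends (hp.update e le_rfl zero_le_one) rfl
    unfold HMF at hres ⊢
    rwa [HMFc_update_zero_of_loop p ends hx] at hres
  · -- no parallel pair, no loop: the reduced case is simple, otherwise leaf / series moves
    have hnopar : ∀ e₁ e₂, p e₁ ≠ 0 → p e₂ ≠ 0 → e₁ ≠ e₂ → ends e₁ ≠ ends e₂ :=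
      fun e₁ e₂ h1 h2 hne h => hpar ⟨e₁, e₂, h1, h2, hne, h⟩
    have hnoloopAll : ∀ e, p e ≠ 0 → ¬ (ends e).IsDiag := fun e h1 h => hloop ⟨e, h1, h⟩
    by_cases hred : Reduced p ends o a₁ a₂ a₃ b
    · exact H p ends hp ⟨hred, hnoloopAll, hnopar⟩
    obtain ⟨v, hvo, hv1, hv2, hv3, hvb, hviol⟩ : ∃ v, v ≠ o ∧ v ≠ a₁ ∧ v ≠ a₂ ∧ v ≠ a₃ ∧ v ≠ b ∧
        ¬ ((∀ e, p e ≠ 0 → ends e ≠ s(v, v)) ∧ (nzDeg p ends v = 0 ∨ 3 ≤ nzDeg p ends v)) := by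
      by_contra hcon
      apply hred
      intro v hvo hv1 hv2 hv3 hvb
      by_contra h
      exact hcon ⟨v, hvo, hv1, hv2, hv3, hvb, h⟩
    have hnoloop : ∀ e, p e ≠ 0 → ends e ≠ s(v, v) := fun e hpe he =>
      hnoloopAll e hpe (by rw [he]; exact Sym2.mk_isDiag_iff.2 rfl)
    have hdeg : nzDeg p ends v = 1 ∨ nzDeg p ends v = 2 := by
      by_contra h
      apply hviol
      refine ⟨hnoloop, ?_⟩
      omega
    set ends' := reroute p ends a₁ with hends'
    have hagree : ∀ e, p e ≠ 0 → ends e = ends' e := fun e he => (reroute_of_ne p ends a₁ he).symm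
    have hGc : HMFc p ends o a₁ a₂ a₃ b = HMFc p ends' o a₁ a₂ a₃ b :=
      HMFc_congr_nz p hagree o a₁ a₂ a₃ b
    have hS : (Finset.univ.filter (fun e => v ∈ ends' e)).card = nzDeg p ends v :=
      card_filter_reroute p ends hv1
    have hnz : ∀ e, v ∈ ends' e → p e ≠ 0 := fun e he => ne_zero_of_mem_reroute p ends hv1 he
    have hnoloop' : ∀ e, v ∈ ends' e → ends' e ≠ s(v, v) := fun e he h =>
      hnoloop e (hnz e he) (by rw [hagree e (hnz e he)]; exact h)
    unfold HMF
    rw [hGc]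
    rcases hdeg with h1 | h2
    · rw [← hS, Finset.card_eq_one] at h1
      obtain ⟨f, hf⟩ := h1
      have hvf : v ∈ ends' f := by
        have : f ∈ Finset.univ.filter (fun e => v ∈ ends' e) := by
          rw [hf]; exact Finset.mem_singleton_self f
        simpa using this
      have hleaf : ∀ e, v ∈ ends' e → e = f := fun e he => by
        have : e ∈ Finset.univ.filter (fun e => v ∈ ends' e) := by simpa using he
        rw [hf] at this
        exact Finset.mem_singleton.1 this
      obtain ⟨y, hy⟩ := Sym2.mem_iff_exists.1 hvf
      have hvy : v ≠ y := fun h => hnoloop' f hvf (by rw [hy, h])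
      have hpf : p f ≠ 0 := hnz f hvf
      have hmem : f ∈ nz p := mem_nz.2 hpf
      have hcard : (nz (Function.update p f 0)).card < n := by
        rw [nz_update_zero, Finset.card_erase_of_mem hmem, hn]
        exact Nat.sub_lt
          (Nat.pos_of_ne_zero (by rw [← hn]; exact Finset.card_ne_zero_of_mem hmem)) Nat.one_pos
      have hres := ih _ hcard (Function.update p f 0) ends' (hp.update f le_rfl zero_le_one) rfl
      unfold HMF at hres
      rwa [HMFLeafInvisible.HMFc_update_leaf p hy hleaf hvy hvo hv1 hv2 hv3 hvb 0] at hres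
    · rw [← hS, Finset.card_eq_two] at h2
      obtain ⟨f, f', hff, hS2⟩ := h2
      have hmemS : ∀ e, v ∈ ends' e ↔ e = f ∨ e = f' := fun e => by
        have : e ∈ Finset.univ.filter (fun e => v ∈ ends' e) ↔ e ∈ ({f, f'} : Finset E) := by
          rw [hS2]
        simpa using this
      have hvf : v ∈ ends' f := (hmemS f).2 (Or.inl rfl)
      have hvf' : v ∈ ends' f' := (hmemS f').2 (Or.inr rfl)
      have hdeg2 : ∀ e, v ∈ ends' e → e = f ∨ e = f' := fun e he => (hmemS e).1 he
      obtain ⟨w, hw⟩ := Sym2.mem_iff_exists.1 hvf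
      obtain ⟨w', hw'⟩ := Sym2.mem_iff_exists.1 hvf'
      have hvw : v ≠ w := fun h => hnoloop' f hvf (by rw [hw, h])
      have hvw' : v ≠ w' := fun h => hnoloop' f' hvf' (by rw [hw', h])
      have hpf' : p f' ≠ 0 := hnz f' hvf'
      have hmem : f' ∈ nz p := mem_nz.2 hpf'
      have hcard : (nz (Function.update (Function.update p f (p f * p f')) f' 0)).card < n := by
        rw [nz_contract p hff hpf', Finset.card_erase_of_mem hmem, hn]
        exact Nat.sub_lt
          (Nat.pos_of_ne_zero (by rw [← hn]; exact Finset.card_ne_zero_of_mem hmem)) Nat.one_pos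
      have hp₂ : IsProbVec (Function.update (Function.update p f (p f * p f')) f' 0) :=
        (hp.update f (mul_nonneg (hp.nonneg f) (hp.nonneg f'))
          (mul_le_one₀ (hp.le_one f) (hp.nonneg f') (hp.le_one f'))).update f' le_rfl zero_le_one
      have hres := ih _ hcard _ (Function.update ends' f s(w, w')) hp₂ rfl
      exact (SeriesCollapse.HMF_series_contract p hp hff hw hw' hdeg2 hvw hvw' hvo.symm hv1.symm
        hv2.symm hv3.symm hvb.symm).2 hres

variable (R)

/-- **(HCOV) on the simple instances.** -/
def HCov_simple_all : Prop :=
  ∀ (V E : Type) [Fintype V] [DecidableEq V] [Fintype E] [DecidableEq E]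
    (ends : E → Sym2 V) (p : E → R), IsProbVec p →
    ∀ o a₁ a₂ a₃ b : V, a₁ ≠ a₂ → a₁ ≠ a₃ → a₂ ≠ a₃ → o ≠ a₁ → o ≠ a₂ → o ≠ a₃ → o ≠ b →
      b ≠ a₁ → b ≠ a₂ → b ≠ a₃ → Simple p ends o a₁ a₂ a₃ b → HCov p ends o a₁ a₂ a₃ b

variable {R}

/-- **THE CRUX OF RECORD IS REDUCED TO THE SIMPLE GRAPHS**: `HCov_all R` follows from (HCOV) on the
instances without nonzero loops at unmarked vertices, without nonzero parallel pairs, and whose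
unmarked vertices have nonzero-degree `0` or `≥ 3`. -/
theorem HCov_all_of_simple (h : HCov_simple_all R) : HCov_all R := by
  intro V E _ _ _ _ ends p hp o a₁ a₂ a₃ b h12 h13 h23 ho1 ho2 ho3 hob hb1 hb2 hb3
  exact HCov_of_simple o a₁ a₂ a₃ b
    (fun p ends hp hs => h V E ends p hp o a₁ a₂ a₃ b h12 h13 h23 ho1 ho2 ho3 hob hb1 hb2 hb3 hs)
    p ends hp

end Simple
end Skeleton

end Summit.Ventures.PercRepro2
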